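import Summits.ABC.IUTFork.Repair.CandExplicit2
import Literature.IUT.LogVolume.ExplicitEstimatesTheorem51Proof
import HarnessLib

/-!
# IUT REPAIR branch (rung LADDER-ABC:A2.RP ⊆ A2.B), class EXPLICIT (sub-cell B2) — row RP-X02, cells only:
# the KERNEL CROSS-REFERENCE between the census typing of MFHMP Thm. 5.1's NUMBER (`Repair.CandExplicit2`, §5)
# and its independent Literature typing (`Literature.IUT.LogVolume.ExplicitEstimatesTheorem51`)

Record file of the abc-iut cell's REPAIR branch (seat abc-iut-rp-x1, gen 3; branch lead abc-iut-rp-plan; row RP-X02 of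
`HOME/plan/repair/CANDIDATES.tsv`, author abc-iut-rp-x2, word of record RESTATES-STATEMENT · CITES-DOES-NOT-SUPPLY, CLOSED).
PROOF-ONLY: no definition is introduced; nothing of either imported file is edited or restated (DEFS-FREEZE). TAKES NO SIDE
between Mochizuki, Scholze–Stix, Joshi, Dupuy–Hilado, MFHMP or anyone; nothing here asserts abc or [IUTchIII] Cor. 3.12 proved or
refuted; kernel-EQUAL typings are a statement about two Lean texts, not an endorsement of the printed claim (typed ≠ proved).

SOURCE (both typings). S. Mochizuki, I. Fesenko, Y. Hoshi, A. Minamide, W. Porowski, *Explicit estimates in inter-universal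
Teichmüller theory* (= RIMS Preprint 1933; Kodai Math. J. **45** (2022) 175–236), **Theorem 5.1**, bib key `MochizukiEtAl2022`
(claim key, status disputed). The census typing `CandExplicit2` (p427695, abc-iut-rp-x2) reads the kurims render
`paper:url-282b4741d9d5` (Thm 5.1 p. 33 l. 9–13, p. 34 l. 22–48); the Literature typing (lit-abc-explicitiut)
reads the cell's Kodai render (pdf p35.l63–100 = journal p. 209; file `ExplicitEstimatesTheorem51.lean` p453106). The Literature file records in PROSE (its header, «Cross-reference
(not importable from `Literature/`)») that its `Thm110Numerics.cTheta51` «is, field for field, `Repair.CandExplicit2.cTheta …` of the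
cell's census row RP-X02» — a Literature module cannot import a Summits module, so that sentence had no kernel witness. THIS FILE IS
THAT WITNESS, stated at every `X : Literature.IUT.LogVolume.Thm110Numerics` (the [IUTchIV] Thm. 1.10 numerics REUSED by the
Literature typing as the carrier), with RP-X02's six real parameters instantiated by the dictionary
`(l, d_mod, e*_mod, log 𝔡, log 𝔣, log 𝔮) ↦ (X.l, X.dmod, X.estar, X.logDiffTpd, X.logCondTpd, X.logq)`.

WHAT IS PROVED (all by unfolding + `rfl` / `ring` / `linarith`; axioms standard):
* §1 DICTIONARY — `absLogq_eq_absLogQ` (`|log(q)| = (1/2l)·log 𝔮`, definitional), `bracket51_eq_inflation_sub_heightTerm`,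
  `cTheta51_eq_cTheta` (the Literature's VERBATIM `C_Θ` of Thm. 5.1 IS RP-X02's `cTheta`, digit-exact: `4.08803`, `12`, `1 − 12/l²`,
  `(l+1)/(4·|log(q)|)`, `− 1`), `display51_iff_finalInequality` (the printed conclusion, digit-exact: `20`, `4.0881`).
* §2 THE «C_Θ ≥ −1» READINGS COINCIDE — RP-X02's `neg_one_le_cTheta_iff` («height term ≤ inflation term») instantiates at every
  `X` (its side conditions `0 < l`, `0 < log 𝔮` are fields of `X`) and says the same as the Literature's `neg_one_le_cTheta51_iff`
  («`0 ≤ {braces}`»): `heightTerm_le_inflation_iff_bracket51_nonneg`, `rpX02_neg_one_le_cTheta_iff_at`, `neg_one_le_cTheta_iff_lit`.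
* §3 TRANSPORTED CONSEQUENCES — RP-X02's file types the printed conclusion `FinalInequality` and declares it «not asserted, not
  re-derived»; the Literature typing PROVED the derivation «`{braces} ≥ 0` ⟹ display» for `l ≥ 839` (`display51_of_bracket51_nonneg`)
  and the whole last sentence of Thm. 5.1 as an implication from the HYPOTHESES `CTheta51Admissible` and `Thm110Numerics.Cor312`
  (`theorem51_of_admissible`), and Thm. 5.1 AS PRINTED from the proof's INPUT data `ProofData51` (`theorem51`, companion file
  `ExplicitEstimatesTheorem51Proof.lean` p454837). Through §1 these land in RP-X02's vocabulary:
  `finalInequality_of_heightTerm_le_inflation`, `finalInequality_of_neg_one_le_cTheta`, `finalInequality_of_cor312`,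
  `finalInequality_of_proofData51`.

READING FOR THE TABLE (RP-X02 `notes`/`decl` cells; the words are the lead's): the two independent typings of MFHMP Thm. 5.1's
number AGREE IN THE KERNEL, and on BOTH the only Cor-3.12 content entering the displayed inequality is a HYPOTHESIS — the typed
`Statement` ≡ `CandExplicit2.H` under `|log q| > 0` on the census side (`CandExplicit2.H_iff_statement`), the predicate
`Thm110Numerics.Cor312` (`−|log(q)| ≤ −|log(Θ)|`) on the Literature side: CITES-DOES-NOT-SUPPLY is now readable off one kernel object
joining the two files. NOT decided here (different carriers, no bridge typed in the tree): any map from a pinned `Cor312Vol` setting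
`P` of the census bed to a `Thm110Numerics` — RP-X02's setting-level `H` and the Literature's number-level predicates are compared
only through the real-arithmetic §5 of `CandExplicit2`, which is all the printed sentence offers at the level of numbers.
-/

noncomputable section

namespace Summit.ABC.IUTFork.Repair.CandExplicit2LitTwins

open Literature.IUT.LogVolume Literature.IUT.LogVolume.Thm110Numerics

variable (X : Literature.IUT.LogVolume.Thm110Numerics)

/-! ## 1. The dictionary: RP-X02's §5 numbers ARE the Literature's [ExpEst] Thm. 5.1 numbers -/

/-- `|log(q)| = (1/2l)·log(𝔮)` — the Literature's `Thm110Numerics.absLogq` (p35.l63–69) and RP-X02's `CandExplicit2.absLogQ`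
(MFHMP p. 34 l. 22–24) are the SAME expression `log 𝔮 / (2·l)`, definitionally. [cite: MochizukiEtAl2022, Thm 5.1 p. 34 l. 22–24] -/
theorem absLogq_eq_absLogQ : X.absLogq = CandExplicit2.absLogQ (X.l : ℝ) X.logq := rfl

/-- The braces: the Literature's `bracket51` (p35.l75–86) = RP-X02's `inflation − heightTerm` (p. 34 l. 35–40) — same coefficients
`1 + 12·d_mod/l`, `4.08803·e*_mod·l`, `(1/6)(1 − 12/l²)·log 𝔮`. [cite: MochizukiEtAl2022, Thm 5.1 p. 34 l. 30–42] -/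
theorem bracket51_eq_inflation_sub_heightTerm :
    X.bracket51 =
      CandExplicit2.inflation (X.l : ℝ) X.dmod X.estar X.logDiffTpd X.logCondTpd
        - CandExplicit2.heightTerm (X.l : ℝ) X.logq := by
  unfold bracket51 CandExplicit2.inflation CandExplicit2.heightTerm
  ring

/-- **The twin claim, kernel-checked**: the Literature's VERBATIM `C_Θ` of [ExpEst] Thm. 5.1 (`Thm110Numerics.cTheta51`, p35.l71–87)
EQUALS RP-X02's `CandExplicit2.cTheta` (MFHMP p. 34 l. 30–42) under the dictionary `(l, d_mod, e*_mod, log 𝔡^{F_tpd}, log 𝔣^{F_tpd},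
log 𝔮) ↦ (X.l, X.dmod, X.estar, X.logDiffTpd, X.logCondTpd, X.logq)`, at every numerics `X`. This is the sentence «field for field»
of the Literature file's header, which a `Literature/` module could not state. [cite: MochizukiEtAl2022, Thm 5.1 p. 34 l. 30–42] -/
theorem cTheta51_eq_cTheta :
    X.cTheta51 = CandExplicit2.cTheta (X.l : ℝ) X.dmod X.estar X.logDiffTpd X.logCondTpd X.logq := by
  unfold cTheta51 CandExplicit2.cTheta
  rw [bracket51_eq_inflation_sub_heightTerm, absLogq_eq_absLogQ]

/-- The printed conclusion: the Literature's first display `Display51` (p35.l90–95) ⟺ RP-X02's `FinalInequality` (p. 34 l. 45–48) —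
same coefficients `1/6`, `1 + 20·d_mod/l`, `4.0881·e*_mod·l`. Both are claim-tagged `Prop` definitions, neither is asserted; the
equivalence is pure bookkeeping. [cite: MochizukiEtAl2022, Thm 5.1 p. 34 l. 45–48] -/
theorem display51_iff_finalInequality :
    X.Display51 ↔ CandExplicit2.FinalInequality (X.l : ℝ) X.dmod X.estar X.logDiffTpd X.logCondTpd X.logq := by
  unfold Display51 CandExplicit2.FinalInequality
  constructor <;> intro h <;> linarith [mul_assoc (4.0881 : ℝ) (X.estar : ℝ) (X.l : ℝ)]

/-! ## 2. The two readings of «C_Θ ≥ −1» coincide -/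

/-- RP-X02's «height term ≤ inflation term» ⟺ the Literature's «`0 ≤ {braces}`», at every `X` (by §1). [folklore] -/
theorem heightTerm_le_inflation_iff_bracket51_nonneg :
    CandExplicit2.heightTerm (X.l : ℝ) X.logq ≤ CandExplicit2.inflation (X.l : ℝ) X.dmod X.estar X.logDiffTpd X.logCondTpd
      ↔ 0 ≤ X.bracket51 := by
  rw [bracket51_eq_inflation_sub_heightTerm, sub_nonneg]

/-- RP-X02's lemma `CandExplicit2.neg_one_le_cTheta_iff` INSTANTIATES at every Literature numerics `X`: its two side conditions
`0 < l`, `0 < log 𝔮` are the fields `5 ≤ l` / `0 < log 𝔮` of `Thm110Numerics`. So at `X`: `−1 ≤ C_Θ ⟺ heightTerm ≤ inflation`.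
[folklore] -/
theorem rpX02_neg_one_le_cTheta_iff_at :
    -1 ≤ CandExplicit2.cTheta (X.l : ℝ) X.dmod X.estar X.logDiffTpd X.logCondTpd X.logq ↔
      CandExplicit2.heightTerm (X.l : ℝ) X.logq
        ≤ CandExplicit2.inflation (X.l : ℝ) X.dmod X.estar X.logDiffTpd X.logCondTpd :=
  CandExplicit2.neg_one_le_cTheta_iff _ _ _ _ (by linarith [X.five_le_l_real]) X.logq_pos

/-- … and it SAYS THE SAME as the Literature's own `Thm110Numerics.neg_one_le_cTheta51_iff` (`−1 ≤ C_Θ ⟺ 0 ≤ {braces}`): the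
census reading and the Literature reading of «C_Θ ≥ −1» are one statement. Proved here through RP-X02's lemma and §1 only (the
Literature lemma is not used), so the agreement is a genuine cross-check of the two files. [folklore] -/
theorem neg_one_le_cTheta_iff_lit :
    -1 ≤ CandExplicit2.cTheta (X.l : ℝ) X.dmod X.estar X.logDiffTpd X.logCondTpd X.logq ↔ 0 ≤ X.bracket51 := by
  rw [rpX02_neg_one_le_cTheta_iff_at, heightTerm_le_inflation_iff_bracket51_nonneg]

/-- The same agreement read against the Literature lemma directly: both files' «C_Θ ≥ −1» predicates are equivalent (indeed the
constants are equal, `cTheta51_eq_cTheta`). [folklore] -/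
theorem neg_one_le_cTheta51_iff_neg_one_le_cTheta :
    -1 ≤ X.cTheta51 ↔ -1 ≤ CandExplicit2.cTheta (X.l : ℝ) X.dmod X.estar X.logDiffTpd X.logCondTpd X.logq := by
  rw [cTheta51_eq_cTheta]

/-! ## 3. Transported consequences: the Literature's PROVED derivations land in RP-X02's vocabulary -/

variable {X}

/-- **«height term ≤ inflation term ⟹ the printed conclusion», for `l ≥ 839`** — RP-X02's file types `FinalInequality` as «not
asserted, not re-derived»; the Literature typing PROVED the printed passage «by applying the inequality “C_Θ ≥ −1” … conclude that»
(`display51_of_bracket51_nonneg`, kernel route valid iff `l ≥ 839`, so under the printed `l ≥ 10¹⁵`). Transported through §1.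
Pure real arithmetic; nothing about any IUT object or elliptic curve is asserted. [cite: MochizukiEtAl2022, Thm 5.1 p. 34 l. 43–48] -/
theorem finalInequality_of_heightTerm_le_inflation (h839 : 839 ≤ X.l)
    (h : CandExplicit2.heightTerm (X.l : ℝ) X.logq
      ≤ CandExplicit2.inflation (X.l : ℝ) X.dmod X.estar X.logDiffTpd X.logCondTpd) :
    CandExplicit2.FinalInequality (X.l : ℝ) X.dmod X.estar X.logDiffTpd X.logCondTpd X.logq :=
  (display51_iff_finalInequality X).1
    (display51_of_bracket51_nonneg h839 ((heightTerm_le_inflation_iff_bracket51_nonneg X).1 h))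

/-- **«C_Θ ≥ −1 ⟹ the printed conclusion», for `l ≥ 839`**, with `C_Θ` RP-X02's `cTheta`. [cite: MochizukiEtAl2022, Thm 5.1 p. 34 l. 43–48] -/
theorem finalInequality_of_neg_one_le_cTheta (h839 : 839 ≤ X.l)
    (h : -1 ≤ CandExplicit2.cTheta (X.l : ℝ) X.dmod X.estar X.logDiffTpd X.logCondTpd X.logq) :
    CandExplicit2.FinalInequality (X.l : ℝ) X.dmod X.estar X.logDiffTpd X.logCondTpd X.logq :=
  finalInequality_of_heightTerm_le_inflation h839 ((rpX02_neg_one_le_cTheta_iff_at X).1 h)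

/-- **The last sentence of MFHMP Thm. 5.1 in RP-X02's vocabulary, as an implication from its HYPOTHESES** (Literature
`theorem51_of_admissible`, transported): for numerics with `l ≥ 10¹⁵`, IF [ExpEst]'s constant is admissible (`CTheta51Admissible`:
`−|log(Θ)| ≤ C_Θ·|log(q)|`, the content of the printed proof) and IF the μ₆-version of [IUTchIII] Cor. 3.12 holds for these numerics
(`Thm110Numerics.Cor312`: `−|log(q)| ≤ −|log(Θ)|` — a HYPOTHESIS, the disputed statement, never asserted), THEN RP-X02's `cTheta ≥ −1`
and RP-X02's `FinalInequality` hold. This is where the kernel shows CITES-DOES-NOT-SUPPLY on the Literature typing too: `Cor312` is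
an input. No side taken; nothing asserted about any elliptic curve. [cite: MochizukiEtAl2022, Thm 5.1 p. 33 l. 9–13, p. 34 l. 43–48] -/
theorem finalInequality_of_cor312 (hL : 10 ^ 15 ≤ X.l) (h1 : X.CTheta51Admissible) (h2 : X.Cor312) :
    -1 ≤ CandExplicit2.cTheta (X.l : ℝ) X.dmod X.estar X.logDiffTpd X.logCondTpd X.logq ∧
      CandExplicit2.FinalInequality (X.l : ℝ) X.dmod X.estar X.logDiffTpd X.logCondTpd X.logq := by
  have hC : -1 ≤ X.cTheta51 := neg_one_le_cTheta51 h1 h2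
  have hC' := (neg_one_le_cTheta51_iff_neg_one_le_cTheta X).1 hC
  exact ⟨hC', finalInequality_of_neg_one_le_cTheta (le839_of_largeL hL) hC'⟩

/-- **MFHMP Thm. 5.1 AS PRINTED, in RP-X02's vocabulary** (Literature `Thm110Numerics.theorem51`, transported): from the printed
proof's INPUT data `ProofData51 X` (the μ₆ hull bound with the Step (v) coefficient `4 + 10⁻¹³`, [ExpEst] Prop. 2.2 (i) at `e*_mod·l`,
the unchanged Step (ii)/(iii) displays of [IUTchIV] Thm. 1.10 — all INPUT fields, typed by the Literature seat, none asserted), the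
printed `l ≥ 10¹⁵`, and the HYPOTHESIS `Thm110Numerics.Cor312` (the μ₆-version of the disputed Corollary for these numerics), RP-X02's
`cTheta ≥ −1` and RP-X02's `FinalInequality` follow. Every input other than `Cor312` is printed proof data or PROVED arithmetic: the
Cor-3.12 debt of MFHMP Thm. 5.1 is exactly the hypothesis `hcor`. No side taken; nothing asserted about any elliptic curve.
[cite: MochizukiEtAl2022, Thm 5.1 p. 33 l. 9–13, p. 34 l. 17–48] -/
theorem finalInequality_of_proofData51 (P : ProofData51 X) (hL : 10 ^ 15 ≤ X.l) (hcor : X.Cor312) :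
    -1 ≤ CandExplicit2.cTheta (X.l : ℝ) X.dmod X.estar X.logDiffTpd X.logCondTpd X.logq ∧
      CandExplicit2.FinalInequality (X.l : ℝ) X.dmod X.estar X.logDiffTpd X.logCondTpd X.logq := by
  obtain ⟨-, hC, hD, -⟩ := theorem51 P hL hcor
  exact ⟨(neg_one_le_cTheta51_iff_neg_one_le_cTheta X).1 hC, (display51_iff_finalInequality X).1 hD⟩

/-- Conversely nothing is gained: at every `X`, RP-X02's «`cTheta ≥ −1`» is EXACTLY the Literature's «`cTheta51 ≥ −1`», so any
derivation of the one from `Thm110Numerics.Cor312` is a derivation of the other — the census row and the Literature interface carry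
the same Cor-3.12 debt (restated here as the equality of the two debts as `Prop`s). [folklore] -/
theorem same_debt :
    (X.Cor312 → X.CTheta51Admissible → -1 ≤ X.cTheta51) ↔
      (X.Cor312 → X.CTheta51Admissible →
        -1 ≤ CandExplicit2.cTheta (X.l : ℝ) X.dmod X.estar X.logDiffTpd X.logCondTpd X.logq) := by
  rw [cTheta51_eq_cTheta]

end Summit.ABC.IUTFork.Repair.CandExplicit2LitTwins

end
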